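import Summits.AtomisticToContinuum.Crystallization.Theorems.FrustratedLawDichotomyStrainedPatchAffineCut
import Summits.AtomisticToContinuum.Crystallization.Theorems.FrustratedLawDichotomyStrainedPatchShearDoorA
import Summits.AtomisticToContinuum.Crystallization.Theorems.FrustratedLawDichotomyStrainedPatchRecutLevelA

/-!
# Aperiodic strained patch — SECTOR TRANSPORT across the affine recut, PART A (cell decomp-a2c-lens-5, g104; SECTOR-103 / SECTOR-104)

Companion of `…StrainedPatchAffineCut` (the DOOR-Tᴬ supplier (125b)) for the HYSTERESIS bookkeeping of
`…AperiodicGapRecordJunctionHysteresis` (#41): the balanced refit moves a chart to a RECUT host `z₁` whose window is the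
`(1+A)`-image of the source window (`‖A‖ ≤ 3/160`), so a sector predicate `𝓡` of the source host is NOT inherited verbatim by
the target host (SECTOR-103) — but every KINEMATIC clause is inherited up to the relative factor `1 + ‖A‖ ≤ 163/160`.  This file
types that transport once and for all and re-derives the supplier with the transported class folded into the target family.

* §1 `RWRecut A z₀ c₀ z₁ c₁` — the recut relation WITH the RW presentation of the source exposed (matrix box `‖G − 1‖ ≤ 9/50`,
  `‖ξ‖ ≤ 1/10`, window separation `3/4 @ 16`; `RecutOf` of …RecutChart forgets these, and the window clause of a shear door does
  not transport without them); `RecutStable 𝓡 𝓡' α` — «every `α`-recut of an `𝓡`-host is an `𝓡'`-host»; closure under `famAnd`,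
  monotonicity, and the registered goodness piece `RecutGoodA ⟹ RecutStable 𝓘₀ (lowLevel η₁) (3/160)`.
* §2 ★ `balancedRefit_affBal_stable` — the generic DOOR-Tᴬ supplier of (125b) §5 with an ARBITRARY transported class folded into
  the target: `MomentRoom + RecutStable 𝓘_N (lowLevel η₁) (3/160) + RecutStable 𝓘_N 𝓡' (3/160) ⟹
  BalancedRefit 𝓘_N (famAnd (compFamilyW bends1 η₁) 𝓡') (affBal r) … tauA (affTol (1/25) (1/52))` (same proof, same literals;
  (125b) §5 is the case `𝓡' = ⊤`).
* §3 local conjugacy of an RW-recut at `‖A‖ ≤ 1/50` (the `1/150`-pinned `recutOf_local` of …RecutLevel re-pinned), and the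
  kinematic transports: `Dense d ↦ Dense ((1+α)·d)`, the door's distance clause `≤ d ↦ ≤ (1+α)·d`, and the host-column route to
  target goodness (`goodAtScale_recut`: host `η₀`-good + `ShellGap g` + nn-cap ⟹ target `((η₀+(2+η₀)α)/(1−α))`-good; at the
  record `η₀ = 3/100, g = 9/160 ⟹ 7/100 = eta30` — the tightened-host alternative to census item GOOD-103).

PART B (`…SectorTransport`) transports the Gram WINDOW clause of a shear door and assembles the record door / band cells.
All statements are finite-dimensional bookkeeping. [formal bookkeeping] throughout; no new mathematics.
-/

noncomputable section

namespace Summit.AtomisticToContinuum.Crystallization.Theorems.FrustratedLawDichotomyStrainedPatchSectorTransport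

open scoped BigOperators Classical RealInnerProductSpace
open Summit.AtomisticToContinuum.Crystallization.Theorems.ChargedEnergyGapNegative (E3)
open Summit.AtomisticToContinuum.Crystallization.Theorems.FrustratedLawDichotomyPeriodicBlockFlags (goodAtScale_mono)
open Summit.AtomisticToContinuum.Crystallization.Theorems.FrustratedLawDichotomyRangeCut (Sep)
open Summit.AtomisticToContinuum.Crystallization.Theorems.FrustratedLawDichotomyMotifLemmas (GoodAtScale)
open Summit.AtomisticToContinuum.Crystallization.Theorems.FrustratedLawDichotomyAveragingCut (ball mem_ball)
open Summit.AtomisticToContinuum.Crystallization.Theorems.FrustratedLawDichotomyStrainedPatchHomSplit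
open Summit.AtomisticToContinuum.Crystallization.Theorems.FrustratedLawDichotomyStrainedPatchCleanCollar (CleanBall)
open Summit.AtomisticToContinuum.Crystallization.Theorems.FrustratedLawDichotomyStrainedPatchPhaseCut (MonoPhaseBall)
open Summit.AtomisticToContinuum.Crystallization.Theorems.FrustratedLawDichotomyStrainedPatchCoreTube (NearHomIsoAt)
open Summit.AtomisticToContinuum.Crystallization.Theorems.FrustratedLawDichotomyStrainedPatchChartFamilies (ChartBy FamilyLE)
open Summit.AtomisticToContinuum.Crystallization.Theorems.FrustratedLawDichotomyStrainedPatchChartFamiliesBent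
open Summit.AtomisticToContinuum.Crystallization.Theorems.FrustratedLawDichotomyStrainedPatchChartFamiliesPinned
open Summit.AtomisticToContinuum.Crystallization.Theorems.FrustratedLawDichotomyStrainedPatchEnvelopeLaw (dev bends1)
open Summit.AtomisticToContinuum.Crystallization.Theorems.FrustratedLawDichotomyStrainedPatchQuantSlaving
open Summit.AtomisticToContinuum.Crystallization.Theorems.FrustratedLawDichotomyStrainedPatchGradedTube
open Summit.AtomisticToContinuum.Crystallization.Theorems.FrustratedLawDichotomyStrainedPatchPairTube (PairTab lowLevel)
open Summit.AtomisticToContinuum.Crystallization.Theorems.FrustratedLawDichotomyStrainedPatchWindowFamilies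
open Summit.AtomisticToContinuum.Crystallization.Theorems.FrustratedLawDichotomyStrainedPatchRecutPairs
open Summit.AtomisticToContinuum.Crystallization.Theorems.FrustratedLawDichotomyStrainedPatchRecutKinematics
open Summit.AtomisticToContinuum.Crystallization.Theorems.FrustratedLawDichotomyStrainedPatchRecutBuild
open Summit.AtomisticToContinuum.Crystallization.Theorems.FrustratedLawDichotomyStrainedPatchRecutRecord
open Summit.AtomisticToContinuum.Crystallization.Theorems.FrustratedLawDichotomyStrainedPatchRecutChart
open Summit.AtomisticToContinuum.Crystallization.Theorems.FrustratedLawDichotomyStrainedPatchRecutLevel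
open Summit.AtomisticToContinuum.Crystallization.Theorems.FrustratedLawDichotomyStrainedPatchKernelCut
open Summit.AtomisticToContinuum.Crystallization.Theorems.FrustratedLawDichotomyStrainedPatchStiffSector
open Summit.AtomisticToContinuum.Crystallization.Theorems.FrustratedLawDichotomyStrainedPatchStiffDoor
open Summit.AtomisticToContinuum.Crystallization.Theorems.FrustratedLawDichotomyStrainedPatchShearDoor
open Summit.AtomisticToContinuum.Crystallization.Theorems.FrustratedLawDichotomyStrainedPatchAffineCut
open Literature.Geometry.DiscreteGeometry (nearestDist nearestDist_nonneg)

variable {M₀ M₁ : ℕ}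

/-! ## §1. The RW-recut relation and recut-stable classes -/

/-- **`RWRecut A z₀ c₀ z₁ c₁`** — `z₁` (centre `c₁`) is THE `A`-recut of the RW-presented host `z₀` (centre `c₀`): both injective,
same centre POINT, and for some RW presentation `(φ, b₀, G, ξ, s)` of `z₀` IN THE INTERIOR BOX (`b₀ ∈ bends0`, `‖G − 1‖ ≤ 9/50`,
`‖ξ‖ ≤ 1/10`, window separation `3/4 @ 16`, window `s` of radius `133/10`) the target is `z₁ j = z₁ c₁ + b₁ (w j)` with `b₁ ∈ bends1`
the conjugate bending (`b₁ ∘ (1+A) = (1+A) ∘ b₀`) and `w` an injective enumeration of the RE-CUT window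
`{u ∈ latSet φ ((1+A)G) ξ : ‖u‖ ≤ 133/10}` with `w c₁ = 0`.  (`RecutOf` of …RecutChart = this minus the box clauses plus labels.) -/
def RWRecut (A : E3 →L[ℝ] E3) (z₀ : Fin M₀ → E3) (c₀ : Fin M₀) (z₁ : Fin M₁ → E3) (c₁ : Fin M₁) : Prop :=
  Function.Injective z₀ ∧ Function.Injective z₁ ∧ z₁ c₁ = z₀ c₀ ∧
    ∃ (φ : Bool) (b₀ b₁ : E3 → E3) (G : E3 →L[ℝ] E3) (ξ : E3) (s : Fin M₀ → E3) (w : Fin M₁ → E3), b₀ ∈ bends0 ∧ b₁ ∈ bends1 ∧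
      ‖G - 1‖ ≤ 9 / 50 ∧ ‖ξ‖ ≤ 1 / 10 ∧ WindowSep φ b₀ G ξ 16 (3 / 4) ∧ Set.range s = homRange φ G ξ (133 / 10) (s c₀) ∧
      (∀ k, z₀ k - z₀ c₀ = b₀ (s k - s c₀)) ∧ (∀ v, b₁ (((1 : E3 →L[ℝ] E3) + A) v) = ((1 : E3 →L[ℝ] E3) + A) (b₀ v)) ∧
      Function.Injective w ∧ Set.range w = {u : E3 | u ∈ latSet φ (((1 : E3 →L[ℝ] E3) + A) * G) ξ ∧ ‖u‖ ≤ 133 / 10} ∧ w c₁ = 0 ∧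
      ∀ j, z₁ j = z₁ c₁ + b₁ (w j)

/-- **`RecutStable 𝓡 𝓡' α`** — every `α`-recut (`‖A‖ ≤ α`) of a host of class `𝓡` is a host of class `𝓡'`: the HYSTERESIS form of
sector preservation (SECTOR-103: with `𝓡' = 𝓡` and a strict / zero-margin `𝓡` this is false; with `𝓡'` = `𝓡` relaxed outward by the
relative factor `1+α` it is the content of §3 and of PART B). -/
def RecutStable (𝓡 𝓡' : ChartFam) (α : ℝ) : Prop :=
  ∀ (M₀ : ℕ) (z₀ : Fin M₀ → E3) (c₀ : Fin M₀), 𝓡 M₀ z₀ c₀ → ∀ A : E3 →L[ℝ] E3, ‖A‖ ≤ α →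
    ∀ (M₁ : ℕ) (z₁ : Fin M₁ → E3) (c₁ : Fin M₁), RWRecut A z₀ c₀ z₁ c₁ → 𝓡' M₁ z₁ c₁

/-- Monotonicity: antitone in the source class and the radius, monotone in the target class. [formal bookkeeping] -/
theorem RecutStable.mono {𝓡 𝓡' 𝓢 𝓢' : ChartFam} {α α' : ℝ} (h : RecutStable 𝓡 𝓡' α) (h₁ : FamilyLE 𝓢 𝓡) (h₂ : FamilyLE 𝓡' 𝓢')
    (hα : α' ≤ α) : RecutStable 𝓢 𝓢' α' :=
  fun M₀ z₀ c₀ hz A hA M₁ z₁ c₁ hr => h₂ M₁ z₁ c₁ (h M₀ z₀ c₀ (h₁ M₀ z₀ c₀ hz) A (hA.trans hα) M₁ z₁ c₁ hr)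

/-- Closure under conjunction of classes. [formal bookkeeping] -/
theorem RecutStable.and {𝓡₁ 𝓡₁' 𝓡₂ 𝓡₂' : ChartFam} {α : ℝ} (h₁ : RecutStable 𝓡₁ 𝓡₁' α) (h₂ : RecutStable 𝓡₂ 𝓡₂' α) :
    RecutStable (famAnd 𝓡₁ 𝓡₂) (famAnd 𝓡₁' 𝓡₂') α :=
  fun M₀ z₀ c₀ hz A hA M₁ z₁ c₁ hr => ⟨h₁ M₀ z₀ c₀ hz.1 A hA M₁ z₁ c₁ hr, h₂ M₀ z₀ c₀ hz.2 A hA M₁ z₁ c₁ hr⟩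

/-- Two transports from the SAME source class combine. [formal bookkeeping] -/
theorem RecutStable.and' {𝓡 𝓡₁' 𝓡₂' : ChartFam} {α : ℝ} (h₁ : RecutStable 𝓡 𝓡₁' α) (h₂ : RecutStable 𝓡 𝓡₂' α) :
    RecutStable 𝓡 (famAnd 𝓡₁' 𝓡₂') α :=
  fun M₀ z₀ c₀ hz A hA M₁ z₁ c₁ hr => ⟨h₁ M₀ z₀ c₀ hz A hA M₁ z₁ c₁ hr, h₂ M₀ z₀ c₀ hz A hA M₁ z₁ c₁ hr⟩

/-- A class held by every host is recut-stable from anything. [formal bookkeeping] -/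
theorem recutStable_of_forall {𝓡 𝓡' : ChartFam} {α : ℝ} (h : ∀ (M₁ : ℕ) (z₁ : Fin M₁ → E3) (c₁ : Fin M₁), 𝓡' M₁ z₁ c₁) :
    RecutStable 𝓡 𝓡' α :=
  fun _ _ _ _ _ _ M₁ z₁ c₁ _ => h M₁ z₁ c₁

/-- An RW-recut is a `RecutOf` (…RecutChart) for the empty label set. [formal bookkeeping] -/
theorem RWRecut.recutOf {A : E3 →L[ℝ] E3} {z₀ : Fin M₀ → E3} {c₀ : Fin M₀} {z₁ : Fin M₁ → E3} {c₁ : Fin M₁} (h : RWRecut A z₀ c₀ z₁ c₁) :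
    ∃ (e₀ : Fin 0 → Fin M₀) (e₁ : Fin 0 → Fin M₁), RecutOf A z₀ c₀ z₁ c₁ e₀ e₁ := by
  obtain ⟨-, -, -, φ, b₀, b₁, G, ξ, s, w, hb₀, hb₁, -, -, -, hs, hzs, hconj, hwinj, hwr, hwc, hz₁⟩ := h
  exact ⟨fun a => a.elim0, fun a => a.elim0, φ, b₀, b₁, G, ξ, s, w, hb₀, hb₁, hs, hzs, hconj, hwinj, hwr, hwc, hz₁, fun a => a.elim0⟩

/-- The registered goodness piece: `RecutGoodA 𝓘₀ η₁` (…AffineCutA §3) IS recut-stability of `𝓘₀` into the low-level class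
`lowLevel η₁` (centre `η₁`-good at scale `3/2`) at radius `3/160`. [formal bookkeeping] -/
theorem recutStable_lowLevel_of_recutGoodA {𝓘₀ : ChartFam} {η₁ : ℝ} (h : RecutGoodA 𝓘₀ η₁) : RecutStable 𝓘₀ (lowLevel η₁) (3 / 160) := by
  intro M₀ z₀ c₀ hz A hA M₁ z₁ c₁ hr
  obtain ⟨e₀, e₁, hRO⟩ := hr.recutOf
  exact h M₀ z₀ c₀ hz A hA M₁ z₁ c₁ 0 e₀ e₁ hRO hr.2.2.1

/-! ## §2. The generic DOOR-Tᴬ supplier with a transported class folded into the target -/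

/-- ★ **DOOR-Tᴬ supplier, recut-stable form** (= (125b) §5 `balancedRefit_affBal_of_room` with the target family
`famAnd (compFamilyW bends1 η₁) 𝓡'` for ANY class `𝓡'` into which the N-family is `3/160`-recut-stable, and with the goodness
hypothesis in its recut-stable form).  Same construction: `A := lsMat …` (`‖A‖ ≤ 3/160` by the moment room), the `A`-recut of the
RW-presented host, exact affine balance on `ball r`, tube `tauA = 4/25` / table `affTol (1/25) (1/52)`; the recut IS an `RWRecut`
(the RW box clauses come from `InteriorChartW bends0 beta0 xi0 sep0`), so BOTH recut-stability hypotheses apply to it. [formal bookkeeping] -/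
theorem balancedRefit_affBal_stable {𝓘_N 𝓡' : ChartFam} (hN : FamilyLE 𝓘_N ChartFamilyRW) {r κ : ℝ} (hr : r ≤ 63 / 10) (hκ0 : 0 ≤ κ)
    (hκ : κ ≤ 15 / 32) {T₀ : SlackTab} (hR : MomentRoom 𝓘_N r κ (1 / 25) T₀) {η₁ : ℝ} (hG : RecutStable 𝓘_N (lowLevel η₁) (3 / 160))
    (hS : RecutStable 𝓘_N 𝓡' (3 / 160)) {ρ ε η₂ : ℝ} :
    BalancedRefit 𝓘_N (famAnd (compFamilyW bends1 η₁) 𝓡') (affBal r) ρ ε η₂ (1 / 25) T₀ tauA (affTol (1 / 25) (1 / 52)) := by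
  intro M z c M₀ z₀ c₀ e hz hcl hm _ _ hchG
  have hI : ChartFamilyRW M₀ z₀ c₀ := hN M₀ z₀ c₀ hchG.1.1
  have hinj₀ : Function.Injective z₀ := hI.1.1.1
  obtain ⟨φ, b₀, G, ξ, hb₀, hP₀, hGm, hξ, hW⟩ := hI.2
  have hG950 : ‖G - 1‖ ≤ 9 / 50 := hGm.trans (by norm_num [beta0])
  have hξ10 : ‖ξ‖ ≤ 1 / 10 := hξ.trans (by norm_num [xi0])
  have hW34 : WindowSep φ b₀ G ξ 16 (3 / 4) := by simpa only [sep0] using hW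
  obtain ⟨-, -, s, hs, hzs⟩ := hP₀
  obtain ⟨Y, hXY, hYs, hY⟩ := hR M z c M₀ z₀ c₀ e hz hcl hm hchG
  have hd : ∀ b ∈ ball r z c, ‖dev z c z₀ c₀ e b‖ ≤ 1 / 25 := fun b hb => norm_dev_le_of_chartByG hchG hr hb
  have hA : ‖lsMat (ball r z c) (fun a => z₀ (e a) - z₀ c₀) (fun a => dev z c z₀ c₀ e a) Y‖ ≤ 3 / 160 :=
    (norm_lsMat_le hYs (by norm_num) hκ0 hd hY).trans (by nlinarith)
  set A : E3 →L[ℝ] E3 := lsMat (ball r z c) (fun a => z₀ (e a) - z₀ c₀) (fun a => dev z c z₀ c₀ e a) Y with hAdef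
  obtain ⟨b₁, M₁, w, c₁, hb₁, hconj, hwinj, hwr, hwc, -, hbent, hinj₁, hsep⟩ :=
    exists_recut_fifty hb₀ hG950 (hξ10.trans (by norm_num)) hW34 A (hA.trans (by norm_num)) (z₀ c₀)
  have hb₁0 : b₁ 0 = 0 := polyBend_zero (q₂ := 11 / 2000) (q₃ := 11 / 20000) (by simpa [bends1] using hb₁)
  have hz₁c : (fun j => z₀ c₀ + b₁ (w j)) c₁ = z₀ c₀ := by simp only [hwc, hb₁0, add_zero]
  have hRW : RWRecut A z₀ c₀ (fun j => z₀ c₀ + b₁ (w j)) c₁ :=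
    ⟨hinj₀, hinj₁, hz₁c, φ, b₀, b₁, G, ξ, s, w, hb₀, hb₁, hG950, hξ10, hW34, hs, hzs, hconj, hwinj, hwr, hwc, fun j => by rw [hz₁c]⟩
  have hgood₁ : GoodAtScale η₁ (3 / 2) (fun j => z₀ c₀ + b₁ (w j)) c₁ := hG M₀ z₀ c₀ hchG.1.1 A hA _ _ _ hRW
  have hmem : famAnd (compFamilyW bends1 η₁) 𝓡' M₁ (fun j => z₀ c₀ + b₁ (w j)) c₁ :=
    ⟨compFamilyW_of_sepBent subset_rfl hinj₁ hsep hbent hgood₁, hS M₀ z₀ c₀ hchG.1.1 A hA _ _ _ hRW⟩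
  obtain ⟨hch₁, hlab⟩ := chartByG_recutA hchG.1 hinj₀ hb₀ hs hzs A hA hb₁0 hconj hwinj hwr hwc (z₀ c₀) hmem
  have hcomp : (⇑(LinearIsometryEquiv.refl ℝ E3) ∘ z) = z := funext fun _ => rfl
  refine ⟨LinearIsometryEquiv.refl ℝ E3, M₁, fun j => z₀ c₀ + b₁ (w j), c₁, fun a => idxOf w c₁ (((1 : E3 →L[ℝ] E3) + A) (s (e a) - s c₀)), ?_, ?_⟩
  · rw [hcomp]; exact hch₁
  · rw [hcomp]
    intro L
    have key : ∀ a ∈ ball r z c,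
        ⟪dev z c (fun j => z₀ c₀ + b₁ (w j)) c₁ (fun a => idxOf w c₁ (((1 : E3 →L[ℝ] E3) + A) (s (e a) - s c₀))) a,
          L ((fun j => z₀ c₀ + b₁ (w j)) ((fun a => idxOf w c₁ (((1 : E3 →L[ℝ] E3) + A) (s (e a) - s c₀))) a) - (fun j => z₀ c₀ + b₁ (w j)) c₁)⟫ =
        ⟪dev z c z₀ c₀ e a - A (z₀ (e a) - z₀ c₀), (L.comp ((1 : E3 →L[ℝ] E3) + A)) (z₀ (e a) - z₀ c₀)⟫ := by
      intro a ha
      have ha' : dist (z a) (z c) ≤ 63 / 10 := ((mem_ball).1 ha).trans hr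
      have hl := hlab a ha'
      have hdev₁ : dev z c (fun j => z₀ c₀ + b₁ (w j)) c₁ (fun a => idxOf w c₁ (((1 : E3 →L[ℝ] E3) + A) (s (e a) - s c₀))) a =
          dev z c z₀ c₀ e a - A (z₀ (e a) - z₀ c₀) := by
        simp only [dev]
        rw [hl, show ((1 : E3 →L[ℝ] E3) + A) (z₀ (e a) - z₀ c₀) = (z₀ (e a) - z₀ c₀) + A (z₀ (e a) - z₀ c₀) from rfl]
        abel
      rw [hdev₁, ContinuousLinearMap.comp_apply]
      exact congrArg _ (congrArg _ hl)
    rw [Finset.sum_congr rfl key]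
    exact lsMat_balanced hXY hYs _

/-- Consistency: (125b) §5 `balancedRefit_affBal_of_room` is the case `𝓡' = ⊤` of the recut-stable supplier. [formal bookkeeping] -/
example {𝓘_N : ChartFam} (hN : FamilyLE 𝓘_N ChartFamilyRW) {r κ : ℝ} (hr : r ≤ 63 / 10) (hκ0 : 0 ≤ κ) (hκ : κ ≤ 15 / 32)
    {T₀ : SlackTab} (hR : MomentRoom 𝓘_N r κ (1 / 25) T₀) {η₁ : ℝ} (hG : RecutGoodA 𝓘_N η₁) {ρ ε η₂ : ℝ} :
    BalancedRefit 𝓘_N (compFamilyW bends1 η₁) (affBal r) ρ ε η₂ (1 / 25) T₀ tauA (affTol (1 / 25) (1 / 52)) :=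
  BalancedRefit.mono_target (balancedRefit_affBal_stable (𝓡' := fun _ _ _ => True) hN hr hκ0 hκ hR
    (recutStable_lowLevel_of_recutGoodA hG) (recutStable_of_forall fun _ _ _ => trivial)) famAnd_le

/-! ## §3. Local conjugacy of an RW-recut at `‖A‖ ≤ 1/50`; the kinematic transports -/

/-- **Local conjugacy** (…RecutLevel `recutOf_local` re-pinned from `1/150` to `1/50`): within distance `3` of the common centre,
the recut sites are EXACTLY the `(1+A)`-images of the chart sites (both directions).  Radii: a recut window vector `u'` with
`‖(1+A)(b₀ u)‖ ≤ 3` has `‖b₀ u‖ ≤ 16/5`, `‖u‖ ≤ 16/5 + 219/100 < 133/10`; a chart window vector `σ` with `‖b₀ σ‖ ≤ 3` has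
`‖σ‖ ≤ 51/10`, `‖(1+A)σ‖ ≤ (51/50)(51/10) < 133/10`. [formal bookkeeping] -/
theorem RWRecut.conj_local {A : E3 →L[ℝ] E3} {z₀ : Fin M₀ → E3} {c₀ : Fin M₀} {z₁ : Fin M₁ → E3} {c₁ : Fin M₁}
    (h : RWRecut A z₀ c₀ z₁ c₁) (hA : ‖A‖ ≤ 1 / 50) :
    (∀ k', dist (z₁ k') (z₁ c₁) ≤ 3 → ∃ k, z₁ k' - z₁ c₁ = ((1 : E3 →L[ℝ] E3) + A) (z₀ k - z₀ c₀)) ∧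
      ∀ k, dist (z₀ k) (z₀ c₀) ≤ 3 → ∃ k', z₁ k' - z₁ c₁ = ((1 : E3 →L[ℝ] E3) + A) (z₀ k - z₀ c₀) := by
  obtain ⟨-, -, -, φ, b₀, b₁, G, ξ, s, w, hb₀, -, -, -, -, hs, hzs, hconj, -, hwr, -, hz₁⟩ := h
  have hσ : ∀ k, s k - s c₀ ∈ latSet φ G ξ ∧ ‖s k - s c₀‖ ≤ 133 / 10 := by
    intro k
    have hk : s k ∈ homRange φ G ξ (133 / 10) (s c₀) := hs ▸ ⟨k, rfl⟩
    rw [mem_homRange_iff, dist_eq_norm] at hk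
    exact ⟨hk.2, hk.1⟩
  have hdiff₁ : ∀ j, z₁ j - z₁ c₁ = b₁ (w j) := fun j => by rw [hz₁ j, add_sub_cancel_left]
  refine ⟨fun k' hk' => ?_, fun k hk => ?_⟩
  · have hwj : w k' ∈ Set.range w := ⟨k', rfl⟩
    rw [hwr] at hwj
    obtain ⟨hlat, hnorm⟩ := hwj
    rw [latSet_mul] at hlat
    obtain ⟨u, hu, huj⟩ := hlat
    have hu68 : ‖u‖ ≤ 68 / 5 := norm_le_window_fifty A hA (by rw [huj]; exact hnorm)
    have hd : dist (z₁ k') (z₁ c₁) = ‖((1 : E3 →L[ℝ] E3) + A) (b₀ u)‖ := by rw [dist_eq_norm, hdiff₁, ← huj, hconj]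
    rw [hd] at hk'
    have hal := antilipschitz_one_add A hA (b₀ u)
    have hbu : ‖b₀ u‖ ≤ 16 / 5 := by nlinarith
    have hu13 : ‖u‖ ≤ 133 / 10 := by have h := norm_le_of_bends0_window_fifty hb₀ hu68; linarith
    have hsu : s c₀ + u ∈ Set.range s := by
      rw [hs, mem_homRange_iff, dist_eq_norm, add_sub_cancel_left]
      exact ⟨hu13, hu⟩
    obtain ⟨k, hk⟩ := hsu
    have hσk : s k - s c₀ = u := by rw [hk, add_sub_cancel_left]
    exact ⟨k, by rw [hdiff₁, ← huj, hconj, hzs, hσk]⟩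
  · have hb : ‖b₀ (s k - s c₀)‖ ≤ 3 := by rw [← hzs, ← dist_eq_norm]; exact hk
    have hmem : ((1 : E3 →L[ℝ] E3) + A) (s k - s c₀) ∈ Set.range w := by
      rw [hwr]
      refine ⟨?_, ?_⟩
      · rw [latSet_mul]; exact ⟨s k - s c₀, (hσ k).1, rfl⟩
      · have hb' := norm_le_of_bends0_window hb₀ (hσ k).2
        have h1 := norm_one_add_apply_le A hA (s k - s c₀)
        nlinarith
    obtain ⟨k', hk'⟩ := hmem
    exact ⟨k', by rw [hdiff₁, hk', hconj, hzs]⟩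

/-- A chart site OTHER than the centre within distance `3` has a recut partner OTHER than the centre. [formal bookkeeping] -/
theorem RWRecut.site {A : E3 →L[ℝ] E3} {z₀ : Fin M₀ → E3} {c₀ : Fin M₀} {z₁ : Fin M₁ → E3} {c₁ : Fin M₁}
    (h : RWRecut A z₀ c₀ z₁ c₁) (hA : ‖A‖ ≤ 1 / 50) {k : Fin M₀} (hk : k ≠ c₀) (hk3 : dist (z₀ k) (z₀ c₀) ≤ 3) :
    ∃ k', k' ≠ c₁ ∧ z₁ k' - z₁ c₁ = ((1 : E3 →L[ℝ] E3) + A) (z₀ k - z₀ c₀) := by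
  obtain ⟨k', hk'⟩ := (h.conj_local hA).2 k hk3
  refine ⟨k', fun hkc => ?_, hk'⟩
  have hne : z₀ k - z₀ c₀ ≠ 0 := sub_ne_zero.2 fun heq => hk (h.1 heq)
  have h0 := one_add_apply_ne_zero A hA (by norm_num) hne
  rw [← hk', hkc, sub_self] at h0
  exact h0 rfl

/-- **Dense transport**: `Dense d ↦ Dense ((1+α)·d)` across an `α`-recut (`α ≤ 1/50`, `d ≤ 3`). [formal bookkeeping] -/
theorem recutStable_dense {d α : ℝ} (hα : α ≤ 1 / 50) (hd : d ≤ 3) : RecutStable (Dense d) (Dense ((1 + α) * d)) α := by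
  intro M₀ z₀ c₀ hz A hA M₁ z₁ c₁ hr
  obtain ⟨a, ha, hda⟩ := hz
  obtain ⟨k', hk', hk⟩ := hr.site (hA.trans hα) ha (by linarith)
  have hα0 : 0 ≤ α := (norm_nonneg A).trans hA
  have hlt : ‖z₀ a - z₀ c₀‖ < d := by rwa [← dist_eq_norm]
  refine ⟨k', hk', ?_⟩
  calc dist (z₁ k') (z₁ c₁) = ‖((1 : E3 →L[ℝ] E3) + A) (z₀ a - z₀ c₀)‖ := by rw [dist_eq_norm, hk]
    _ ≤ (1 + α) * ‖z₀ a - z₀ c₀‖ := norm_one_add_apply_le A hA _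
    _ < (1 + α) * d := mul_lt_mul_of_pos_left hlt (by linarith)

/-- **Door-distance transport**: «a site other than the centre within CLOSED distance `d`» `↦` the same at `(1+α)·d`. [formal bookkeeping] -/
theorem recutStable_near {d α : ℝ} (hα : α ≤ 1 / 50) (hd : d ≤ 3) :
    RecutStable (fun _ z₀ c₀ => ∃ a, a ≠ c₀ ∧ dist (z₀ a) (z₀ c₀) ≤ d) (fun _ z₁ c₁ => ∃ a, a ≠ c₁ ∧ dist (z₁ a) (z₁ c₁) ≤ (1 + α) * d) α := by
  intro M₀ z₀ c₀ hz A hA M₁ z₁ c₁ hr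
  obtain ⟨a, ha, hda⟩ := hz
  obtain ⟨k', hk', hk⟩ := hr.site (hA.trans hα) ha (by linarith)
  have hα0 : 0 ≤ α := (norm_nonneg A).trans hA
  have hle : ‖z₀ a - z₀ c₀‖ ≤ d := by rwa [← dist_eq_norm]
  refine ⟨k', hk', ?_⟩
  calc dist (z₁ k') (z₁ c₁) = ‖((1 : E3 →L[ℝ] E3) + A) (z₀ a - z₀ c₀)‖ := by rw [dist_eq_norm, hk]
    _ ≤ (1 + α) * ‖z₀ a - z₀ c₀‖ := norm_one_add_apply_le A hA _
    _ ≤ (1 + α) * d := mul_le_mul_of_nonneg_left hle (by linarith)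

/-- The door's distance clause transports (its goodness clause is NOT transported here — the target's goodness is supplied by the
competitor family, `famAnd_compFamilyW_near_le_door`). [formal bookkeeping] -/
theorem recutStable_door_near {d η α : ℝ} (hα : α ≤ 1 / 50) (hd : d ≤ 3) :
    RecutStable (Door d η) (fun _ z₁ c₁ => ∃ a, a ≠ c₁ ∧ dist (z₁ a) (z₁ c₁) ≤ (1 + α) * d) α :=
  (recutStable_near hα hd).mono (fun _ _ _ h => h.1) (fun _ _ _ h => h) le_rfl

/-- Target-side upgrade: inside the competitor family `compFamilyW 𝓑 η₁` (centre `η₁`-good) the transported distance clause IS the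
door `Door d η` for any `η ≥ η₁` — the door's goodness literal needs NO inflation (GOODNESS-104). [formal bookkeeping] -/
theorem famAnd_compFamilyW_near_le_door {𝓑 : Set (E3 → E3)} {η₁ η d : ℝ} (hη : η₁ ≤ η) {𝓟 : ChartFam} :
    FamilyLE (famAnd (compFamilyW 𝓑 η₁) (famAnd (fun _ z₁ c₁ => ∃ a, a ≠ c₁ ∧ dist (z₁ a) (z₁ c₁) ≤ d) 𝓟))
      (famAnd (compFamilyW 𝓑 η₁) (famAnd (Door d η) 𝓟)) :=
  fun _ _ _ h => ⟨h.1, ⟨h.2.1, goodAtScale_mono hη h.1.2.2.2.2⟩, h.2.2⟩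

/-- **Host-column route to target goodness** (the tightened-host alternative to census item GOOD-103, critic r1641 (C)):
if every N-host is `η₀`-good at scale `3/2`, has shell gap `g ≥ 3α` and `(1+α)·nn ≤ 3/2`, then every `α`-recut (`α ≤ 1/50`) is
`((η₀ + (2+η₀)α)/(1−α))`-good at scale `3/2` (…RecutLevelA `goodAtScale_recut` + local conjugacy §3). [formal bookkeeping] -/
theorem recutStable_lowLevel_of_hostColumns {𝓘 : ChartFam} {η₀ g α : ℝ} (hα : α ≤ 1 / 50) (hg : 3 * α ≤ g) (hg0 : 0 < g)
    (hg1 : g ≤ 1 / 10) (hη₀ : η₀ ≤ 1)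
    (h𝓘 : FamilyLE 𝓘 (fun _ z₀ c₀ => GoodAtScale η₀ (3 / 2) z₀ c₀ ∧ ShellGap g z₀ c₀ ∧ (1 + α) * nearestDist z₀ c₀ ≤ 3 / 2)) :
    RecutStable 𝓘 (lowLevel ((η₀ + (2 + η₀) * α) / (1 - α))) α := by
  intro M₀ z₀ c₀ hz A hA M₁ z₁ c₁ hr
  obtain ⟨h0, HG, hD⟩ := h𝓘 M₀ z₀ c₀ hz
  have hα0 : 0 ≤ α := (norm_nonneg A).trans hA
  obtain ⟨H1, H2⟩ := hr.conj_local (hA.trans hα)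
  exact goodAtScale_recut hr.1 hr.2.1 A hA (hα.trans (by norm_num)) hg hg0 hg1 H1 H2 HG (by nlinarith [nearestDist_nonneg z₀ c₀]) hη₀ hD h0

/-- Record: host columns `η₀ = 3/100`, `g = 9/160`, `(163/160)·nn ≤ 3/2` give `eta30 = 7/100`-good recuts at radius `3/160`
(`(3/100 + (203/100)(3/160))/(157/160) = 1089/15700 ≤ 7/100`). [formal bookkeeping] -/
theorem recutStable_lowLevel_eta30_of_hostColumns {𝓘 : ChartFam}
    (h𝓘 : FamilyLE 𝓘 (fun _ z₀ c₀ => GoodAtScale (3 / 100) (3 / 2) z₀ c₀ ∧ ShellGap (9 / 160) z₀ c₀ ∧ (1 + 3 / 160) * nearestDist z₀ c₀ ≤ 3 / 2)) :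
    RecutStable 𝓘 (lowLevel eta30) (3 / 160) :=
  (recutStable_lowLevel_of_hostColumns (by norm_num) (by norm_num) (by norm_num) (by norm_num) (by norm_num) h𝓘).mono
    (fun _ _ _ h => h) (fun _ _ _ h => goodAtScale_mono (by norm_num [eta30]) h) le_rfl

end Summit.AtomisticToContinuum.Crystallization.Theorems.FrustratedLawDichotomyStrainedPatchSectorTransport
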